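import Summits.AtomisticToContinuum.Crystallization.Theorems.OverbindingBudgetAffineFarFieldCollarFacets

/-!
# Tube books of the interface pieces of the Barlow reference tessellation

Support file for route `OverbindingBudget`, crux `RobustDefectLimitWindows` (SW♭(30)·27V, «27VI-SOUND (a2)»): the
`hV` books of `interfaceRow_window` («CollarWindow») for the nearest-neighbour pairs.  From the facet dictionary
of «CollarFacets» (`bondPiece_subset_frame`: the piece `cell u ∩ cell u'` lies in a placed flat box with the frame
of the rhombus facet — determinant `4h³`, dual rows `3/(8h²), 3/(8h²), 1/(2h²)`, `h = ν/(2√2)` — or, only for an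
`h`-site and an in-layer neighbour, possibly of the trapezoid facet — `16h³/3`; `27/(128h²), 3/(8h²), 1/(2h²)`)
and the row volume lemma of «CellFacetsRows» (`volume_cthickening_image_box_le`):

* `rhombusTube ν W = W·(ν + 2√3·W)²/√2` (`= 2W ×` the rhombus area `(√2/4)ν²` at leading order),
* `trapezoidTube ν W = 4W·(ν + (3√3/2)·W)(ν + 2√3·W)/(3√2)` (`= 2W × (√2/3)ν²` at leading order),
* `facetTube s u u' ν W` = trapezoid iff `u` is an `h`-site (`s (u.1-1) ≠ s u.1`) and `u.1 = u'.1`, else rhombus —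
  DECIDABLE on the indices; sound because `rhombusTube ≤ trapezoidTube`; rational majorants `rhombusTube_le_rat`
  (`≤ 0.70711·W·(ν + 3.4642W)²`), `trapezoidTube_le_rat` (`≤ 0.9429·W·(ν + 2.599W)(ν + 3.4642W)`);
* ★ `bondPiece_volume_le`: `volume (cthickening W (cell u ∩ cell u')) ≤ facetTube s u u' ν W` for
  `barlowSiteForm s u u' = 12`, `W ≥ 0` (the `√2`-contacts take `CollarFacets.contactPiece_volume_le`, `(4/3)πW³`).

References: Hales, Dense Sphere Packings (2012) §1.3 [HalesDSP2012]; the tree files cited.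
-/

noncomputable section

namespace Summit.AtomisticToContinuum.Crystallization.Theorems.OverbindingBudgetAffineFarFieldCollarTubes

open Set Metric MeasureTheory Real
open Literature.MathematicalPhysics.StatisticalMechanics
open Literature.Barriers.AtomisticToContinuum (voronoiCell)
open Summit.AtomisticToContinuum.Crystallization.Theorems.OverbindingBudgetAffineFarFieldCellFacetsRows
open Summit.AtomisticToContinuum.Crystallization.Theorems.OverbindingBudgetAffineFarFieldCollarSites
open Summit.AtomisticToContinuum.Crystallization.Theorems.OverbindingBudgetAffineFarFieldCollarFacets

local notation "E3" => EuclideanSpace ℝ (Fin 3)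
local notation "Idx" => ℤ × ℤ × ℤ

variable {s : ℤ → ℤ} {ν : ℝ} {q : E3} {R : E3 ≃ₗᵢ[ℝ] E3}

/-! ## The tube books -/

/-- The tube book of a RHOMBUS facet (every facet of a `k`-cell, the six cap facets of an `h`-cell):
`W·(ν + 2√3·W)²/√2` (`= 2W ×` the area `(√2/4)ν²` at leading order). [this file] -/
def rhombusTube (ν W : ℝ) : ℝ := W * (ν + 2 * Real.sqrt 3 * W) ^ 2 / Real.sqrt 2

/-- The tube book of a TRAPEZOID facet (the six in-layer facets of an `h`-cell):
`4W·(ν + (3√3/2)·W)(ν + 2√3·W)/(3√2)` (`= 2W ×` the area `(√2/3)ν²` at leading order). [this file] -/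
def trapezoidTube (ν W : ℝ) : ℝ :=
  4 * W * ((ν + 3 * Real.sqrt 3 / 2 * W) * (ν + 2 * Real.sqrt 3 * W)) / (3 * Real.sqrt 2)

/-- The tube book of the listed nearest-neighbour pair `(u,u')`: trapezoid iff `u` is an `h`-site and `u'` lies in
its layer (DECIDABLE on the indices), rhombus otherwise. [this file] -/
def facetTube (s : ℤ → ℤ) (u u' : Idx) (ν W : ℝ) : ℝ :=
  if s (u.1 - 1) ≠ s u.1 ∧ u.1 = u'.1 then trapezoidTube ν W else rhombusTube ν W

/-- support: the trapezoid book dominates the rhombus book. [this file] -/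
theorem rhombusTube_le_trapezoidTube {ν W : ℝ} (hν : 0 ≤ ν) (hW : 0 ≤ W) : rhombusTube ν W ≤ trapezoidTube ν W := by
  unfold rhombusTube trapezoidTube
  have hs2 : (0 : ℝ) < Real.sqrt 2 := Real.sqrt_pos.2 two_pos
  have hs3 : (0 : ℝ) ≤ Real.sqrt 3 := Real.sqrt_nonneg 3
  rw [div_le_div_iff₀ hs2 (by positivity), ← sub_nonneg]
  have e : 4 * W * ((ν + 3 * Real.sqrt 3 / 2 * W) * (ν + 2 * Real.sqrt 3 * W)) * Real.sqrt 2 -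
      W * (ν + 2 * Real.sqrt 3 * W) ^ 2 * (3 * Real.sqrt 2) = Real.sqrt 2 * W * (ν + 2 * Real.sqrt 3 * W) * ν := by
    ring
  rw [e]
  positivity

/-- support: the rhombus book is below the pair book. [this file] -/
theorem rhombusTube_le_facetTube (s : ℤ → ℤ) (u u' : Idx) {ν W : ℝ} (hν : 0 ≤ ν) (hW : 0 ≤ W) :
    rhombusTube ν W ≤ facetTube s u u' ν W := by
  unfold facetTube
  split_ifs
  · exact rhombusTube_le_trapezoidTube hν hW
  · exact le_rfl

/-- support: the pair book is below the trapezoid book (uniform fallback). [this file] -/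
theorem facetTube_le_trapezoidTube (s : ℤ → ℤ) (u u' : Idx) {ν W : ℝ} (hν : 0 ≤ ν) (hW : 0 ≤ W) :
    facetTube s u u' ν W ≤ trapezoidTube ν W := by
  unfold facetTube
  split_ifs
  · exact le_rfl
  · exact rhombusTube_le_trapezoidTube hν hW

/-- support: `1.414213 < √2`. [folklore] -/
theorem sqrt_two_gt_1414213 : (1414213 / 1000000 : ℝ) < Real.sqrt 2 := by
  rw [Real.lt_sqrt (by norm_num)]; norm_num

/-- support: `√3 < 1.7321`. [folklore] -/
theorem sqrt_three_lt_17321 : Real.sqrt 3 < 17321 / 10000 := by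
  rw [Real.sqrt_lt' (by norm_num)]; norm_num

/-- support: RATIONAL MAJORANT of the rhombus book: `rhombusTube ν W ≤ 0.70711·W·(ν + 3.4642·W)²`. [this file] -/
theorem rhombusTube_le_rat {ν W : ℝ} (hν : 0 ≤ ν) (hW : 0 ≤ W) :
    rhombusTube ν W ≤ 70711 / 100000 * W * (ν + 34642 / 10000 * W) ^ 2 := by
  unfold rhombusTube
  have hs2 : (0 : ℝ) < Real.sqrt 2 := Real.sqrt_pos.2 two_pos
  have hs3 : (0 : ℝ) ≤ Real.sqrt 3 := Real.sqrt_nonneg 3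
  have h3 := sqrt_three_lt_17321
  have h1 : (1 : ℝ) ≤ 70711 / 100000 * Real.sqrt 2 := by nlinarith [sqrt_two_gt_1414213]
  have hX : 0 ≤ W * (ν + 34642 / 10000 * W) ^ 2 := by positivity
  calc W * (ν + 2 * Real.sqrt 3 * W) ^ 2 / Real.sqrt 2 ≤ W * (ν + 34642 / 10000 * W) ^ 2 / Real.sqrt 2 := by
        gcongr; nlinarith
    _ ≤ 70711 / 100000 * W * (ν + 34642 / 10000 * W) ^ 2 := by
        rw [div_le_iff₀ hs2]; nlinarith [mul_le_mul_of_nonneg_left h1 hX]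

/-- support: RATIONAL MAJORANT of the trapezoid book: `trapezoidTube ν W ≤ 0.9429·W·(ν + 2.599·W)(ν + 3.4642·W)`.
[this file] -/
theorem trapezoidTube_le_rat {ν W : ℝ} (hν : 0 ≤ ν) (hW : 0 ≤ W) :
    trapezoidTube ν W ≤ 9429 / 10000 * W * ((ν + 2599 / 1000 * W) * (ν + 34642 / 10000 * W)) := by
  unfold trapezoidTube
  have hs2 : (0 : ℝ) < Real.sqrt 2 := Real.sqrt_pos.2 two_pos
  have hs3 : (0 : ℝ) ≤ Real.sqrt 3 := Real.sqrt_nonneg 3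
  have h3 := sqrt_three_lt_17321
  have h1 : (4 : ℝ) ≤ 9429 / 10000 * (3 * Real.sqrt 2) := by nlinarith [sqrt_two_gt_1414213]
  have hX : 0 ≤ W * ((ν + 2599 / 1000 * W) * (ν + 34642 / 10000 * W)) := by positivity
  have ha : ν + 3 * Real.sqrt 3 / 2 * W ≤ ν + 2599 / 1000 * W := by nlinarith
  have hb : ν + 2 * Real.sqrt 3 * W ≤ ν + 34642 / 10000 * W := by nlinarith
  calc 4 * W * ((ν + 3 * Real.sqrt 3 / 2 * W) * (ν + 2 * Real.sqrt 3 * W)) / (3 * Real.sqrt 2)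
      ≤ 4 * W * ((ν + 2599 / 1000 * W) * (ν + 34642 / 10000 * W)) / (3 * Real.sqrt 2) := by
        refine div_le_div_of_nonneg_right ?_ (by positivity)
        exact mul_le_mul_of_nonneg_left (mul_le_mul ha hb (by positivity) (by positivity)) (by positivity)
    _ ≤ 9429 / 10000 * W * ((ν + 2599 / 1000 * W) * (ν + 34642 / 10000 * W)) := by
        rw [div_le_iff₀ (by positivity)]; nlinarith [mul_le_mul_of_nonneg_left h1 hX]

/-- support: VOLUME OF A TUBE ABOUT A SET IN AN AFFINE BOX, by dual rows («CellFacetsRows»), with the monotonicity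
step. [this file] -/
theorem volume_cthickening_le_of_subset_image_box {S : Set E3} {p : E3} {T : E3 →L[ℝ] E3} {Rr : Fin 3 → E3}
    (hR : ∀ x i, inner ℝ (Rr i) (T x) = x i) (hsurj : Function.Surjective T) {l h : Fin 3 → ℝ}
    (hlh : ∀ i, l i ≤ h i) (hS : S ⊆ (fun x => p + T x) '' {x : E3 | ∀ i, l i ≤ x i ∧ x i ≤ h i}) {W : ℝ}
    (hW : 0 ≤ W) :
    (volume (cthickening W S)).toReal ≤ |T.det| * ∏ i, (h i - l i + 2 * (‖Rr i‖ * W)) := by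
  refine le_trans ?_ (volume_cthickening_image_box_le T p Rr hR hsurj l h hlh hW)
  have hcpt : IsCompact ((fun x => p + T x) '' {x : E3 | ∀ i, l i ≤ x i ∧ x i ≤ h i}) :=
    (isCompact_coordBox_fin3 l h).image (continuous_const.add T.continuous)
  exact ENNReal.toReal_mono hcpt.cthickening.measure_lt_top.ne (measure_mono (cthickening_subset_of_subset W hS))

/-- ★ support: TUBE BOOK OF A FACET — for a nearest-neighbour pair `(u,u')` (`barlowSiteForm = 12`) and `W ≥ 0`,
`volume (cthickening W (cell u ∩ cell u')) ≤ facetTube s u u' ν W`. This is the `hV` book of `interfaceRow_window`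
for the form-12 pairs (the form-24 pairs take `contactPiece_volume_le`). [this file] -/
theorem bondPiece_volume_le (hs : IsHaggSeq s) (hν : 0 < ν) {u u' : Idx} (h12 : barlowSiteForm s u u' = 12)
    {W : ℝ} (hW : 0 ≤ W) :
    (volume (cthickening W (voronoiCell (range (placedSite s ν q R)) (placedSite s ν q R u) ∩
        voronoiCell (range (placedSite s ν q R)) (placedSite s ν q R u')))).toReal ≤ facetTube s u u' ν W := by
  obtain ⟨trap, p, T, Rr, htrap, hdet, hsurj, hR, hρ, hsub⟩ := bondPiece_subset_frame (q := q) (R := R) hs hν h12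
  have hv := volume_cthickening_le_of_subset_image_box hR hsurj (by intro i; fin_cases i <;> simp) hsub hW
  refine hv.trans ?_
  have hs2 : (0 : ℝ) < Real.sqrt 2 := Real.sqrt_pos.2 two_pos
  have hs3 : (0 : ℝ) ≤ Real.sqrt 3 := Real.sqrt_nonneg 3
  have h3 : Real.sqrt 3 ^ 2 = 3 := Real.sq_sqrt (by norm_num)
  have hh2 : (ν / (2 * Real.sqrt 2)) ^ 2 = ν ^ 2 / 8 := by
    rw [div_pow, mul_pow, Real.sq_sqrt two_pos.le]; ring
  have hh3 : (ν / (2 * Real.sqrt 2)) ^ 3 = ν ^ 2 / 8 * (ν / (2 * Real.sqrt 2)) := by rw [pow_succ, hh2]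
  rw [Fin.prod_univ_three]
  simp only [Matrix.cons_val_zero, Matrix.cons_val_one, Matrix.cons_val_two, Matrix.head_cons, Matrix.tail_cons,
    zero_div, neg_zero, sub_zero, add_zero]
  cases trap
  · -- rhombus frame
    simp only [Bool.false_eq_true, ↓reduceIte] at hdet hρ
    have hR0 : ‖Rr 0‖ = Real.sqrt 3 / ν := by
      refine (pow_left_inj₀ (norm_nonneg _) (by positivity) two_ne_zero).1 ?_
      rw [hρ 0]
      simp only [Matrix.cons_val_zero]
      rw [hh2, div_pow, h3]; field_simp
    have hR1 : ‖Rr 1‖ = Real.sqrt 3 / ν := by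
      refine (pow_left_inj₀ (norm_nonneg _) (by positivity) two_ne_zero).1 ?_
      rw [hρ 1]
      simp only [Matrix.cons_val_zero, Matrix.cons_val_one]
      rw [hh2, div_pow, h3]; field_simp
    have hR2 : ‖Rr 2‖ = 2 / ν := by
      refine (pow_left_inj₀ (norm_nonneg _) (by positivity) two_ne_zero).1 ?_
      rw [hρ 2]
      simp only [Matrix.cons_val_two, Matrix.head_cons, Matrix.tail_cons]
      rw [hh2, div_pow]; field_simp; norm_num
    rw [hdet, hR0, hR1, hR2, hh3]
    refine le_trans (le_of_eq ?_) (rhombusTube_le_facetTube s u u' hν.le hW)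
    unfold rhombusTube
    field_simp
    ring
  · -- trapezoid frame: only for an `h`-site and an in-layer neighbour
    obtain ⟨hb, hl⟩ := htrap rfl
    simp only [↓reduceIte] at hdet hρ
    have hR0 : ‖Rr 0‖ = 3 * Real.sqrt 3 / (4 * ν) := by
      refine (pow_left_inj₀ (norm_nonneg _) (by positivity) two_ne_zero).1 ?_
      rw [hρ 0]
      simp only [Matrix.cons_val_zero]
      rw [hh2, div_pow, mul_pow, h3]; field_simp; norm_num
    have hR1 : ‖Rr 1‖ = Real.sqrt 3 / ν := by
      refine (pow_left_inj₀ (norm_nonneg _) (by positivity) two_ne_zero).1 ?_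
      rw [hρ 1]
      simp only [Matrix.cons_val_zero, Matrix.cons_val_one]
      rw [hh2, div_pow, h3]; field_simp
    have hR2 : ‖Rr 2‖ = 2 / ν := by
      refine (pow_left_inj₀ (norm_nonneg _) (by positivity) two_ne_zero).1 ?_
      rw [hρ 2]
      simp only [Matrix.cons_val_two, Matrix.head_cons, Matrix.tail_cons]
      rw [hh2, div_pow]; field_simp; norm_num
    rw [hdet, hR0, hR1, hR2, hh3]
    have hf : facetTube s u u' ν W = trapezoidTube ν W := by
      unfold facetTube; rw [if_pos ⟨hb, hl⟩]
    rw [hf]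
    unfold trapezoidTube
    apply le_of_eq
    field_simp
    ring

end Summit.AtomisticToContinuum.Crystallization.Theorems.OverbindingBudgetAffineFarFieldCollarTubes
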